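import Mathlib.Probability.Moments.Variance
import Mathlib.Probability.Moments.Covariance
import Mathlib.Algebra.QuadraticDiscriminant
import HarnessLib

/-!
# Covariance bounds from oscillation bounds; law of total covariance with an exceptional event

Topic `Literature/Probability/Moments`.  Elementary second-moment inequalities for bounded real
random variables on a probability space, in the raw-integral form `∫ XY - ∫ X ∫ Y` in which they
are consumed by correlation estimates of lattice models:

* `variance_le_of_forall_abs_sub_le` — **Popoviciu from an oscillation bound**: if all values of
  `Z` lie within `c` of each other then `Var Z ≤ (c/2)²` (the range of `Z` lies in
  `[inf Z, sup Z]`, an interval of length `≤ c`; Popoviciu 1935);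
* `abs_cov_le_of_forall_abs_sub_le` — **covariance of two variables of oscillation `≤ a`, `≤ b`**:
  `|∫ XY - ∫ X ∫ Y| ≤ ab/4` (Popoviciu + Cauchy–Schwarz `Cov(X,Y)² ≤ Var X · Var Y`, the latter
  read off the discriminant of `t ↦ Var(tX - Y) ≥ 0`);
* `abs_integral_le_of_forall_abs_le`, `abs_integral_sub_integral_le_mul_measureReal` —
  bookkeeping: `|∫ f| ≤ C` for `|f| ≤ C`, and `|∫ F - ∫ F'| ≤ 2C μ(E)` when `F = F'` off `E` and
  `|F|, |F'| ≤ C`;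
* `total_covariance_lower_bound` — **law of total covariance with an exceptional event**: for
  measurable `H, K, Q` with `|H|, |K| ≤ K₀`, `|Q| ≤ K₀²` (think: conditional expectations of
  `X`, `Y`, `XY` given a sub-σ-algebra), an event `E` of mass `≤ p`, `Q - HK ≥ θ ≥ 0` off `E` and
  `H`, `K` oscillating by `≤ a`, `≤ b` off `E`:  `θ - ab/4 - (θ + 8K₀²) p ≤ ∫ Q - ∫ H ∫ K`
  (`E[Cov(X,Y | 𝓖)] + Cov(E[X|𝓖], E[Y|𝓖])`, the second term by the previous bullet after freezing
  `H`, `K` on `E`).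

## Mathlib

We USE `ProbabilityTheory.variance_le_sq_of_bounded` (Popoviciu on an interval),
`variance_sub`, `variance_const_mul`, `covariance_const_mul_left`, `covariance_eq_sub`,
`memLp_of_bounded`, `discrim_le_zero`, `abs_le_of_sq_le_sq`.  Mathlib (pinned) has no
Cauchy–Schwarz inequality for `ProbabilityTheory.covariance` and no oscillation form of Popoviciu
(searched `covariance_sq`, `covariance_le`, `abs_covariance`, `osc`).

## References

* T. Popoviciu, *Sur les équations algébriques ayant toutes leurs racines réelles*, Mathematica
  (Cluj) 9 (1935), 129–145 (the variance bound `σ² ≤ (M - m)²/4`).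
* R. Bhatia, C. Davis, *A better bound on the variance*, Amer. Math. Monthly 107 (2000), 353–357.
* R. Durrett, *Probability: Theory and Examples*, 5th ed. (CUP 2019), §1.6 (Cauchy–Schwarz,
  variance algebra), §4.1 (conditional expectation; law of total variance/covariance).
-/

noncomputable section

open MeasureTheory ProbabilityTheory

namespace Literature.Probability.Moments

variable {Ω : Type*} [MeasurableSpace Ω] {μ : Measure Ω}

/-! ## Bookkeeping for bounded integrands -/

/-- Averages of a function bounded by `C` against a probability measure are bounded by `C`. [folklore] -/
theorem abs_integral_le_of_forall_abs_le [IsProbabilityMeasure μ] {f : Ω → ℝ} {C : ℝ}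
    (hf : ∀ ω, |f ω| ≤ C) : |∫ ω, f ω ∂μ| ≤ C := by
  have h := norm_integral_le_of_norm_le_const (μ := μ) (f := f) (C := C)
    (ae_of_all _ fun ω => by simpa [Real.norm_eq_abs] using hf ω)
  simpa [Real.norm_eq_abs] using h

/-- A measurable function bounded by `C` is integrable against a finite measure. [folklore] -/
theorem integrable_of_forall_abs_le [IsFiniteMeasure μ] {f : Ω → ℝ} (hf : AEStronglyMeasurable f μ)
    {C : ℝ} (hC : ∀ ω, |f ω| ≤ C) : Integrable f μ :=
  Integrable.of_bound hf C (ae_of_all _ fun ω => by simpa [Real.norm_eq_abs] using hC ω)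

/-- Two functions bounded by `C` that agree off an event `E` have integrals within `2 C μ(E)`
of each other. [folklore] -/
theorem abs_integral_sub_integral_le_mul_measureReal [IsFiniteMeasure μ] {E : Set Ω}
    (hE : MeasurableSet E) {F F' : Ω → ℝ} {C : ℝ} (hF : ∀ ω, |F ω| ≤ C) (hF' : ∀ ω, |F' ω| ≤ C)
    (heq : ∀ ω, ω ∉ E → F ω = F' ω) (hFi : Integrable F μ) (hF'i : Integrable F' μ) :
    |(∫ ω, F ω ∂μ) - ∫ ω, F' ω ∂μ| ≤ 2 * C * μ.real E := by
  rw [← integral_sub hFi hF'i]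
  have hbound : ∀ ω, ‖F ω - F' ω‖ ≤ E.indicator (fun _ => 2 * C) ω := fun ω => by
    by_cases hω : ω ∈ E
    · rw [Set.indicator_of_mem hω, Real.norm_eq_abs]
      calc |F ω - F' ω| ≤ |F ω| + |F' ω| := abs_sub _ _
        _ ≤ C + C := add_le_add (hF ω) (hF' ω)
        _ = 2 * C := by ring
    · rw [Set.indicator_of_notMem hω, heq ω hω, sub_self, norm_zero]
  calc |∫ ω, (F ω - F' ω) ∂μ| = ‖∫ ω, (F ω - F' ω) ∂μ‖ := (Real.norm_eq_abs _).symm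
    _ ≤ ∫ ω, E.indicator (fun _ => 2 * C) ω ∂μ :=
        norm_integral_le_of_norm_le ((integrable_const _).indicator hE) (ae_of_all _ hbound)
    _ = 2 * C * μ.real E := by rw [integral_indicator_const _ hE, smul_eq_mul, mul_comm]

/-! ## Popoviciu and the covariance bound from oscillation bounds -/

/-- **Popoviciu's inequality from an oscillation bound**: a random variable all of whose values lie
within `c` of each other has variance at most `(c/2)²` (its range lies in the interval
`[inf Z, sup Z]` of length `≤ c`; then Mathlib's `variance_le_sq_of_bounded`) (Popoviciu 1935;
Bhatia–Davis 2000). [folklore] -/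
theorem variance_le_of_forall_abs_sub_le [IsProbabilityMeasure μ] {Z : Ω → ℝ}
    (hZm : AEStronglyMeasurable Z μ) {c : ℝ} (hZ : ∀ ω ω', |Z ω - Z ω'| ≤ c) :
    Var[Z; μ] ≤ (c / 2) ^ 2 := by
  obtain ⟨ω₀⟩ := nonempty_of_isProbabilityMeasure μ
  haveI : Nonempty Ω := ⟨ω₀⟩
  have hle : ∀ ω ω', Z ω - c ≤ Z ω' := fun ω ω' => by
    have h := hZ ω ω'
    rw [abs_le] at h
    linarith
  have hbb : BddBelow (Set.range Z) :=
    ⟨Z ω₀ - c, by rintro _ ⟨ω, rfl⟩; exact hle ω₀ ω⟩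
  have hba : BddAbove (Set.range Z) :=
    ⟨Z ω₀ + c, by rintro _ ⟨ω, rfl⟩; linarith [hle ω ω₀]⟩
  have hlo : ∀ ω, ⨅ ω', Z ω' ≤ Z ω := fun ω => ciInf_le hbb ω
  have hhi : ∀ ω, Z ω ≤ ⨆ ω', Z ω' := fun ω => le_ciSup hba ω
  have hgap : (⨆ ω', Z ω') ≤ (⨅ ω', Z ω') + c :=
    ciSup_le fun ω => (sub_le_iff_le_add).1 (le_ciInf fun ω' => hle ω ω')
  calc Var[Z; μ] ≤ (((⨆ ω', Z ω') - ⨅ ω', Z ω') / 2) ^ 2 :=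
        variance_le_sq_of_bounded (ae_of_all _ fun ω => ⟨hlo ω, hhi ω⟩) hZm.aemeasurable
    _ ≤ (c / 2) ^ 2 :=
        pow_le_pow_left₀ (by linarith [hlo ω₀, hhi ω₀]) (by linarith [hgap]) 2

/-- **Covariance bound from oscillation bounds** (Popoviciu + Cauchy–Schwarz): if all values of
`X` lie within `a` of each other and all values of `Y` within `b`, then
`|∫ XY - ∫ X ∫ Y| ≤ a b / 4` under any probability measure.  Cauchy–Schwarz
`Cov(X,Y)² ≤ Var X · Var Y` is read off the discriminant of `t ↦ Var(tX - Y) ≥ 0`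
(Durrett 2019, §1.6). [folklore] -/
theorem abs_cov_le_of_forall_abs_sub_le [IsProbabilityMeasure μ] {X Y : Ω → ℝ}
    (hXm : AEStronglyMeasurable X μ) (hYm : AEStronglyMeasurable Y μ) {a b : ℝ}
    (hX : ∀ ω ω', |X ω - X ω'| ≤ a) (hY : ∀ ω ω', |Y ω - Y ω'| ≤ b) :
    |(∫ ω, X ω * Y ω ∂μ) - (∫ ω, X ω ∂μ) * ∫ ω, Y ω ∂μ| ≤ a * b / 4 := by
  obtain ⟨ω₀⟩ := nonempty_of_isProbabilityMeasure μ
  have ha : 0 ≤ a := (abs_nonneg _).trans (hX ω₀ ω₀)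
  have hb : 0 ≤ b := (abs_nonneg _).trans (hY ω₀ ω₀)
  have hXr : ∀ ω, X ω ∈ Set.Icc (X ω₀ - a) (X ω₀ + a) := fun ω => by
    have h := hX ω ω₀
    rw [abs_le] at h
    constructor <;> linarith
  have hYr : ∀ ω, Y ω ∈ Set.Icc (Y ω₀ - b) (Y ω₀ + b) := fun ω => by
    have h := hY ω ω₀
    rw [abs_le] at h
    constructor <;> linarith
  have hX2 : MemLp X 2 μ := memLp_of_bounded (ae_of_all _ hXr) hXm 2
  have hY2 : MemLp Y 2 μ := memLp_of_bounded (ae_of_all _ hYr) hYm 2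
  have hVX : Var[X; μ] ≤ (a / 2) ^ 2 := variance_le_of_forall_abs_sub_le hXm hX
  have hVY : Var[Y; μ] ≤ (b / 2) ^ 2 := variance_le_of_forall_abs_sub_le hYm hY
  have hquad : ∀ t : ℝ, 0 ≤ Var[X; μ] * (t * t) + (-2 * cov[X, Y; μ]) * t + Var[Y; μ] := by
    intro t
    have h0 := variance_nonneg ((fun ω => t * X ω) - Y) μ
    rw [variance_sub (hX2.const_mul t) hY2, variance_const_mul, covariance_const_mul_left] at h0
    have : Var[X; μ] * (t * t) + (-2 * cov[X, Y; μ]) * t + Var[Y; μ] =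
        t ^ 2 * Var[X; μ] - 2 * (t * cov[X, Y; μ]) + Var[Y; μ] := by ring
    rw [this]
    exact h0
  have hdisc := discrim_le_zero hquad
  have hcs : cov[X, Y; μ] ^ 2 ≤ Var[X; μ] * Var[Y; μ] := by
    have : discrim (Var[X; μ]) (-2 * cov[X, Y; μ]) (Var[Y; μ]) =
        4 * (cov[X, Y; μ] ^ 2 - Var[X; μ] * Var[Y; μ]) := by
      rw [discrim]; ring
    rw [this] at hdisc
    linarith
  have hsq : cov[X, Y; μ] ^ 2 ≤ (a * b / 4) ^ 2 :=
    calc cov[X, Y; μ] ^ 2 ≤ Var[X; μ] * Var[Y; μ] := hcs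
      _ ≤ (a / 2) ^ 2 * (b / 2) ^ 2 := mul_le_mul hVX hVY (variance_nonneg _ _) (sq_nonneg _)
      _ = (a * b / 4) ^ 2 := by ring
  have habs : |cov[X, Y; μ]| ≤ a * b / 4 := abs_le_of_sq_le_sq hsq (by positivity)
  rw [covariance_eq_sub hX2 hY2] at habs
  simpa only [Pi.mul_apply] using habs

/-! ## The law of total covariance with an exceptional event -/

/-- **Law of total covariance with an exceptional event.**  On a probability space let `E` be an
event of mass `≤ p`, and `H`, `K`, `Q` measurable with `|H|, |K| ≤ K₀`, `|Q| ≤ K₀²` (think: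
conditional expectations of `X`, `Y`, `XY` given a sub-σ-algebra, so that `∫ Q - ∫ H ∫ K` is the
covariance of `X` and `Y`).  If the conditional covariance `Q - H·K` is `≥ θ ≥ 0` off `E` and
`H`, `K` oscillate by `≤ a`, `≤ b` off `E` (`a, b ≥ 0`), then
`θ - ab/4 - (θ + 8K₀²) p ≤ ∫ Q - ∫ H · ∫ K`: the mean of the conditional covariances is
`≥ θ - (θ + 2K₀²) μ(E)`, and the covariance of the conditional means is `≥ -ab/4 - 6K₀² μ(E)` by
`abs_cov_le_of_forall_abs_sub_le` after freezing `H`, `K` on `E` to a good value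
(Durrett 2019, §4.1). [folklore] -/
theorem total_covariance_lower_bound [IsProbabilityMeasure μ] {E : Set Ω} (hE : MeasurableSet E)
    {H Kk Q : Ω → ℝ} (hHm : Measurable H) (hKm : Measurable Kk) (hQm : Measurable Q)
    {K θ a b p : ℝ} (hHK : ∀ ω, |H ω| ≤ K) (hKkK : ∀ ω, |Kk ω| ≤ K) (hQK : ∀ ω, |Q ω| ≤ K ^ 2)
    (hθ : 0 ≤ θ) (ha : 0 ≤ a) (hb : 0 ≤ b) (hlow : ∀ ω, ω ∉ E → θ ≤ Q ω - H ω * Kk ω)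
    (hosc1 : ∀ ω ω', ω ∉ E → ω' ∉ E → |H ω - H ω'| ≤ a)
    (hosc2 : ∀ ω ω', ω ∉ E → ω' ∉ E → |Kk ω - Kk ω'| ≤ b) (hμE : μ.real E ≤ p) :
    θ - a * b / 4 - (θ + 8 * K ^ 2) * p ≤ (∫ ω, Q ω ∂μ) - (∫ ω, H ω ∂μ) * ∫ ω, Kk ω ∂μ := by
  classical
  obtain ⟨ω₁⟩ := nonempty_of_isProbabilityMeasure μ
  have hK : 0 ≤ K := (abs_nonneg _).trans (hHK ω₁)
  have hmul : ∀ {f g : Ω → ℝ}, (∀ ω, |f ω| ≤ K) → (∀ ω, |g ω| ≤ K) → ∀ ω, |f ω * g ω| ≤ K ^ 2 :=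
    fun hf hg ω => by rw [abs_mul, sq]; exact mul_le_mul (hf ω) (hg ω) (abs_nonneg _) hK
  have hHi : Integrable H μ := integrable_of_forall_abs_le hHm.aestronglyMeasurable hHK
  have hKi : Integrable Kk μ := integrable_of_forall_abs_le hKm.aestronglyMeasurable hKkK
  have hQi : Integrable Q μ := integrable_of_forall_abs_le hQm.aestronglyMeasurable hQK
  have hHKb : ∀ ω, |H ω * Kk ω| ≤ K ^ 2 := hmul hHK hKkK
  have hHKi : Integrable (fun ω => H ω * Kk ω) μ :=
    integrable_of_forall_abs_le (hHm.mul hKm).aestronglyMeasurable hHKb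
  have hIH : |∫ ω, H ω ∂μ| ≤ K := abs_integral_le_of_forall_abs_le hHK
  have hIK : |∫ ω, Kk ω ∂μ| ≤ K := abs_integral_le_of_forall_abs_le hKkK
  have hIQ : |∫ ω, Q ω ∂μ| ≤ K ^ 2 := abs_integral_le_of_forall_abs_le hQK
  -- Step 1: the mean of the conditional covariances
  have hstep1 : θ - (θ + 2 * K ^ 2) * μ.real E ≤ (∫ ω, Q ω ∂μ) - ∫ ω, H ω * Kk ω ∂μ := by
    rw [← integral_sub hQi hHKi]
    have hpt : ∀ ω, θ - (θ + 2 * K ^ 2) * E.indicator (fun _ => (1 : ℝ)) ω ≤ Q ω - H ω * Kk ω := by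
      intro ω
      by_cases hω : ω ∈ E
      · rw [Set.indicator_of_mem hω, mul_one]
        have h1 := hQK ω
        have h2 := hHKb ω
        rw [abs_le] at h1 h2
        linarith
      · rw [Set.indicator_of_notMem hω, mul_zero, sub_zero]
        exact hlow ω hω
    have hint : Integrable (fun ω => θ - (θ + 2 * K ^ 2) * E.indicator (fun _ => (1 : ℝ)) ω) μ :=
      (integrable_const _).sub (((integrable_const _).indicator hE).const_mul _)
    calc θ - (θ + 2 * K ^ 2) * μ.real E
        = ∫ ω, (θ - (θ + 2 * K ^ 2) * E.indicator (fun _ => (1 : ℝ)) ω) ∂μ := by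
          rw [integral_sub (integrable_const _) (((integrable_const _).indicator hE).const_mul _),
            integral_const_mul, integral_indicator_const _ hE, integral_const]
          simp
      _ ≤ ∫ ω, (Q ω - H ω * Kk ω) ∂μ := integral_mono hint (hQi.sub hHKi) hpt
  by_cases hgood : ∃ ω₀, ω₀ ∉ E
  · obtain ⟨ω₀, hω₀⟩ := hgood
    -- Step 2: the covariance of the conditional expectations, frozen on `E`
    set H' : Ω → ℝ := E.piecewise (fun _ => H ω₀) H with hH'
    set K' : Ω → ℝ := E.piecewise (fun _ => Kk ω₀) Kk with hK'
    have hH'v : ∀ ω, ∃ ω', ω' ∉ E ∧ H' ω = H ω' := fun ω => by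
      by_cases hω : ω ∈ E
      · exact ⟨ω₀, hω₀, Set.piecewise_eq_of_mem _ _ _ hω⟩
      · exact ⟨ω, hω, Set.piecewise_eq_of_notMem _ _ _ hω⟩
    have hK'v : ∀ ω, ∃ ω', ω' ∉ E ∧ K' ω = Kk ω' := fun ω => by
      by_cases hω : ω ∈ E
      · exact ⟨ω₀, hω₀, Set.piecewise_eq_of_mem _ _ _ hω⟩
      · exact ⟨ω, hω, Set.piecewise_eq_of_notMem _ _ _ hω⟩
    have hH'osc : ∀ ω ω', |H' ω - H' ω'| ≤ a := fun ω ω' => by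
      obtain ⟨η, hη, h1⟩ := hH'v ω
      obtain ⟨η', hη', h2⟩ := hH'v ω'
      rw [h1, h2]; exact hosc1 η η' hη hη'
    have hK'osc : ∀ ω ω', |K' ω - K' ω'| ≤ b := fun ω ω' => by
      obtain ⟨η, hη, h1⟩ := hK'v ω
      obtain ⟨η', hη', h2⟩ := hK'v ω'
      rw [h1, h2]; exact hosc2 η η' hη hη'
    have hH'K : ∀ ω, |H' ω| ≤ K := fun ω => by
      obtain ⟨η, -, h1⟩ := hH'v ω
      rw [h1]; exact hHK η
    have hK'K : ∀ ω, |K' ω| ≤ K := fun ω => by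
      obtain ⟨η, -, h1⟩ := hK'v ω
      rw [h1]; exact hKkK η
    have hH'm : Measurable H' := Measurable.piecewise hE measurable_const hHm
    have hK'm : Measurable K' := Measurable.piecewise hE measurable_const hKm
    have hH'i : Integrable H' μ := integrable_of_forall_abs_le hH'm.aestronglyMeasurable hH'K
    have hK'i : Integrable K' μ := integrable_of_forall_abs_le hK'm.aestronglyMeasurable hK'K
    have hH'K'b : ∀ ω, |H' ω * K' ω| ≤ K ^ 2 := hmul hH'K hK'K
    have hH'K'i : Integrable (fun ω => H' ω * K' ω) μ :=
      integrable_of_forall_abs_le (hH'm.mul hK'm).aestronglyMeasurable hH'K'b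
    have hoff : ∀ ω, ω ∉ E → H' ω = H ω := fun ω hω => Set.piecewise_eq_of_notMem _ _ _ hω
    have hoffK : ∀ ω, ω ∉ E → K' ω = Kk ω := fun ω hω => Set.piecewise_eq_of_notMem _ _ _ hω
    have hcov := abs_cov_le_of_forall_abs_sub_le (μ := μ) hH'm.aestronglyMeasurable
      hK'm.aestronglyMeasurable hH'osc hK'osc
    have hd1 : |(∫ ω, H' ω * K' ω ∂μ) - ∫ ω, H ω * Kk ω ∂μ| ≤ 2 * K ^ 2 * μ.real E :=
      abs_integral_sub_integral_le_mul_measureReal hE hH'K'b hHKb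
        (fun ω hω => by rw [hoff ω hω, hoffK ω hω]) hH'K'i hHKi
    have hd2 : |(∫ ω, H' ω ∂μ) - ∫ ω, H ω ∂μ| ≤ 2 * K * μ.real E :=
      abs_integral_sub_integral_le_mul_measureReal hE hH'K hHK hoff hH'i hHi
    have hd3 : |(∫ ω, K' ω ∂μ) - ∫ ω, Kk ω ∂μ| ≤ 2 * K * μ.real E :=
      abs_integral_sub_integral_le_mul_measureReal hE hK'K hKkK hoffK hK'i hKi
    have hIH' : |∫ ω, H' ω ∂μ| ≤ K := abs_integral_le_of_forall_abs_le hH'K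
    have e1 : |(∫ ω, H' ω ∂μ) * ((∫ ω, K' ω ∂μ) - ∫ ω, Kk ω ∂μ)| ≤ 2 * (K ^ 2 * μ.real E) :=
      calc |(∫ ω, H' ω ∂μ) * ((∫ ω, K' ω ∂μ) - ∫ ω, Kk ω ∂μ)|
          ≤ K * (2 * K * μ.real E) := by
            rw [abs_mul]; exact mul_le_mul hIH' hd3 (abs_nonneg _) hK
        _ = 2 * (K ^ 2 * μ.real E) := by ring
    have e2 : |((∫ ω, H' ω ∂μ) - ∫ ω, H ω ∂μ) * ∫ ω, Kk ω ∂μ| ≤ 2 * (K ^ 2 * μ.real E) :=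
      calc |((∫ ω, H' ω ∂μ) - ∫ ω, H ω ∂μ) * ∫ ω, Kk ω ∂μ|
          ≤ 2 * K * μ.real E * K := by
            rw [abs_mul]; exact mul_le_mul hd2 hIK (abs_nonneg _) (by positivity)
        _ = 2 * (K ^ 2 * μ.real E) := by ring
    have hmp : (θ + 8 * K ^ 2) * μ.real E ≤ (θ + 8 * K ^ 2) * p :=
      mul_le_mul_of_nonneg_left hμE (by positivity)
    rw [abs_le] at hcov hd1 e1 e2
    linarith [hcov.1, hcov.2, hd1.1, hd1.2, e1.1, e1.2, e2.1, e2.2, hstep1, hmp, mul_nonneg ha hb]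
  · -- no good point: `E` has full mass, `p ≥ 1`, and the bound is the trivial one
    have hall : ∀ ω, ω ∈ E := fun ω => by_contra fun hω => hgood ⟨ω, hω⟩
    have hE1 : μ.real E = 1 := by rw [Set.eq_univ_of_forall hall, probReal_univ]
    have hp1 : 1 ≤ p := hE1 ▸ hμE
    have hprod : |(∫ ω, H ω ∂μ) * ∫ ω, Kk ω ∂μ| ≤ K ^ 2 := by
      rw [abs_mul, sq]; exact mul_le_mul hIH hIK (abs_nonneg _) hK
    have h1 : θ + 8 * K ^ 2 ≤ (θ + 8 * K ^ 2) * p := le_mul_of_one_le_right (by positivity) hp1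
    have h2 : 0 ≤ a * b / 4 := by positivity
    rw [abs_le] at hIQ hprod
    nlinarith [hIQ.1, hprod.2, sq_nonneg K]

end Literature.Probability.Moments

end
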